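import Summits.BirchSwinnertonDyer.Rank1Residual.X6.RankZeroCertificateInertPairCoprime
import HarnessLib

/-!
# Class X6 ∧ analytic rank `0` — the ALL-`q` UNIT GUARD «`p ∤ q² − 1` for every `q ∣ N`» (Prasanna 2006 Thm 2.4's standing
# hypothesis `p ∤ M`), decided in the kernel for every record: 41 of the 113 records at `p ≥ 5`; one Rest cell (`399190l1 @ 7`)

Cell `bsd-print-x6` (D-0131 (2) print tier, key `x6`; HOME `run/shared/lean/pub/bsd-print-x6/`), typer seat ty3 (gen 6).
Sibling of `RankZeroCertificateInertPair.lean` (p561444: `Record.inertPairAt`, 113/113 @ `p ≥ 5`), `RankZeroCertificateInertPairNamed.lean`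
(p564740: ty2's `HasInertPair`) and `RankZeroCertificateInertPairCoprime.lean` (p574374: the PAIR-LOCAL unit conjunct
`p ∤ (ℓ₁² − 1)(ℓ₂² − 1)`, 103/113 @ `p ≥ 5`). PARTITION (D-0054): leaf X6 ∧ r = 0 (K3 row A6) — types-the-object-of; closes NONE.
HONEST FRAMING: nothing here asserts BSD or any `L`-value; every theorem is a statement about the primes dividing the conductor of
an explicit minimal model and their residues mod `p`, PROVED from kernel-rechecked integer data.

WHY. The cell referee's R-5.2b (HOME/REFEREE.md §2, INBOX 2026-08-27T21:36:54Z; lit g2 DOSSIER A20-addendum/A21) moved the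
provenance rider of road (I)'s flag `CW24-JSW17-LBDP-identification@HB15` from the pair-local `p ∣ (ℓ₁²−1)(ℓ₂²−1)` to
**`p ∣ ∏_{q ∣ N} (q² − 1)` over ALL primes `q` of the conductor**: the explicit Waldspurger formula behind Castella–Wan 2024
Prop. 2.1 / Brooks Thm 8.2 is Prasanna 2006 Thm 3.2, stated under the paper's STANDING hypothesis of Thm 2.4 (p. 912, read at the
page this session): «for `p ∤ M := ∏_{q ∣ N} q(q − 1)(q + 1)` and `p > k + 1`». In weight `k = 2` with `p ≥ 5` GOOD, `p ∤ q` is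
automatic, so the guard is `∀ q ∣ N prime, p ∤ (q−1)(q+1) = q² − 1` — ty2's announced class-level predicate
`Supersingular.PrasannaUnitGuard W p := ∀ q ∈ (W.conductorNorm ℤ).primeFactors, ¬ p ∣ q ^ 2 - 1` (INBOX 21:40:53Z; not yet in
the tree — THIS file states that body STRUCTURALLY, so the later name is one `Iff.rfl` away). The referee asked ty3 for the census
column «`p ∤ ∏_{q∣N}(q²−1)`» (S-14: his engine gives 41/113; in-kernel twin optional). This file is that twin:

* §0 for a general elliptic `W/ℚ`: a multiplicative prime is a prime factor of `N` (`mem_primeFactors_conductorNorm_of_mult`, from the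
  tree's `dvd_conductorNorm_iff_not_hasGoodReductionAtPrime` and `conductorNorm_pos_holds`), so **under the guard every inert pair
  satisfies the pair-local unit conjunct** (`exists_inertPairCoprime_of_guard_of_hasInertPair`): guard ∧ `HasInertPair` ⊆ p574374's
  narrowed property ⊆ `HasInertPair`.
* §1 the Bool certificate `Record.prasannaGuardAt` (`p ∤ q² − 1` for every LISTED bad prime) and the kernel theorems
  `Record.prasannaGuard_of_check` (⇒ the structural guard on `r.curve`: a prime factor of `N` is a prime of bad reduction, hence
  listed — `mem_badPrimes_of_not_good`) and `Record.not_prasannaGuard_of_check` (certificate `false` ⇒ the guard FAILS: the offending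
  listed prime is multiplicative, hence divides `N`).
* §2 the census (kernel recount = HOME/ty3 python, identical to the referee's S-14 table record for record): at `p ≥ 5` **41 of 113
  records pass the guard** — Err 40 of 107, **Rest 1 of 6 (`399190l1 @ 7`)**; by prime 21/86 @ 5, 14/20 @ 7, 3/4 @ 11, 3/3 @ 13;
  at `p = 3`: 0/621 (any bad prime `q ≠ 3` has `3 ∣ q² − 1`, p574374 `three_dvd_sq_sub_one_of_prime_ne`). Nesting on the census:
  guard (41) ⊆ narrowed pair (103) ⊆ pair (113) at `p ≥ 5`, and on all 734 records `prasannaGuardAt ∧ inertPairAt ⇒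
  inertPairCoprimeAt`. Number of listed primes with `p ∣ q² − 1` per record at `p ≥ 5`: 0 on 41, 1 on 51, 2 on 19, 3 on 2.
  The 41 passing `(label, p)` and the Rest split by label are kernel theorems.
* §3 `hWeq` adapters and the six Rest cells at `p ≥ 5` + the T3 witness cell by name: PASS `399190l1 @ 7` (bad `2, 5, 11, 19, 191`
  ≡ `2, 5, 4, 5, 2 (mod 7)`); FAIL `138594b1 @ 5` (`23099 ≡ −1`), `246697a1 @ 5` (`11 ≡ 1`, `41 ≡ 1`), `321518d1 @ 5` (`19 ≡ −1`,
  `8461 ≡ 1`), `331554a1 @ 5` (`55259 ≡ −1`), `12927e1 @ 7` (`139 ≡ −1 (mod 7)`), and the T3 witness Err cell `22678e1 @ 5` (`29 ≡ −1`).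

Data (Cremona / PARI two engines = records14–16). beyond-print theorem: NO.
References: K. Prasanna, *Integrality of a ratio of Petersson norms and level-lowering congruences*, Ann. of Math. 163 (2006)
901–967, Thm 2.4 (p. 912: standing hypothesis `p ∤ M := ∏_{q∣N} q(q−1)(q+1)`, `p > k+1`; shape only, nothing asserted) [Prasanna2006];
Jetchev–Skinner–Wan 2017, arXiv:1512.06894 p. 21 (`C(f,ψ) ∋ ∏_{ℓ∣N⁻}(ℓ−1)/(ℓ+1)`; shape only) [JetchevSkinnerWan2017]; J. H. Silverman,
*AEC* (2009) VII.5 Prop. 5.1, C.16 [SilvermanAEC2009]; F. Diamond, J. Shurman, §8.3 [DiamondShurman2005]; Cremona's tables [Cremona2006];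
HOME/REFEREE.md R-5.2b / S-14, HOME/DOSSIER.md A20–A21.
-/

set_option autoImplicit false

open WeierstrassCurve Literature.NumberTheory.EllipticCurves
  Literature.NumberTheory.EllipticCurves.Rank1Residual
open Summit.BirchSwinnertonDyer.Rank1Residual.Supersingular (HasInertPair)

namespace Summit.BirchSwinnertonDyer.Rank1Residual.X6.PrintCert

/-! ### §0 The guard for a general elliptic curve over `ℚ` -/

section General

variable {W : WeierstrassCurve ℚ} [W.IsElliptic] {p : ℕ}

/-- A prime of multiplicative reduction is a prime factor of the conductor `N` (`ℓ ∣ N`, `N > 0`).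
[cite: DiamondShurman2005, §8.3 (PDF p. 353)] [cite: SilvermanAEC2009, C.16] -/
theorem mem_primeFactors_conductorNorm_of_mult {ℓ : ℕ} [Fact ℓ.Prime] (hℓ : W.HasMultiplicativeReductionAtPrime ℓ) :
    ℓ ∈ (W.conductorNorm ℤ).primeFactors := by
  have hN : 0 < W.conductorNorm ℤ := W.conductorNorm_pos_holds
  exact Nat.mem_primeFactors.mpr ⟨Fact.out, (W.dvd_conductorNorm_iff_not_hasGoodReductionAtPrime ℓ).mpr
    (WeierstrassCurve.HasMultiplicativeReduction.not_hasGoodReduction (R := ℤ_[ℓ]) hℓ), hN.ne'⟩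

/-- **Under the all-`q` guard every inert pair satisfies the pair-local unit conjunct**: both primes of the pair divide `N`, so
`p ∤ ℓ_i² − 1`, and `p` prime gives `p ∤ (ℓ₁² − 1)(ℓ₂² − 1)` — guard ∧ `HasInertPair` ⊆ the narrowed property of
`RankZeroCertificateInertPairCoprime.lean`. [folklore] -/
theorem exists_inertPairCoprime_of_guard_of_hasInertPair [W.IsGloballyMinimal] [Fact p.Prime]
    (hg : ∀ q ∈ (W.conductorNorm ℤ).primeFactors, ¬ p ∣ q ^ 2 - 1) (h : HasInertPair W p) :
    ∃ ℓ₁ ℓ₂ : ℕ, ∃ _ : Fact ℓ₁.Prime, ∃ _ : Fact ℓ₂.Prime, ℓ₁ ≠ ℓ₂ ∧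
      W.HasMultiplicativeReductionAtPrime ℓ₁ ∧ W.HasMultiplicativeReductionAtPrime ℓ₂ ∧
      ¬ p ∣ padicValInt ℓ₁ W.minimalDiscriminantInt ∧ ¬ p ∣ padicValInt ℓ₂ W.minimalDiscriminantInt ∧
      ¬ p ∣ (ℓ₁ ^ 2 - 1) * (ℓ₂ ^ 2 - 1) := by
  obtain ⟨ℓ₁, ℓ₂, i₁, i₂, hne, h₁, h₂, hr₁, hr₂⟩ := h
  refine ⟨ℓ₁, ℓ₂, i₁, i₂, hne, h₁, h₂, hr₁, hr₂, fun hdvd => ?_⟩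
  rcases (Nat.Prime.dvd_mul (Fact.out : p.Prime)).mp hdvd with hd | hd
  · exact hg ℓ₁ (mem_primeFactors_conductorNorm_of_mult h₁) hd
  · exact hg ℓ₂ (mem_primeFactors_conductorNorm_of_mult h₂) hd

end General

/-! ### §1 The certificate and the kernel theorems -/

namespace Record

variable (r : Record)

/-- **All-`q` unit-guard certificate** of a record: `p ∤ q² − 1` (i.e. `q ≢ ±1 (mod p)`) for every LISTED bad prime `q`
(on X6 the listed primes are exactly the primes of `N`). [folklore] -/
def prasannaGuardAt : Bool :=
  r.bad.all fun t => decide (¬ r.p ∣ t.1 ^ 2 - 1)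

/-- List form of the certificate. [folklore] -/
theorem forall_bad_of_prasannaGuardAt (h : r.prasannaGuardAt = true) : ∀ t ∈ r.bad, ¬ r.p ∣ t.1 ^ 2 - 1 := fun t ht => by
  have hx := List.all_eq_true.mp h t ht
  simp only [decide_eq_true_eq] at hx
  exact hx

/-- **The guard for a certified record with the certificate** (kernel theorem, no claim): for every prime factor `q` of the
conductor of the record's curve, `p ∤ q² − 1` — a prime factor of `N` is a prime of bad reduction
(`dvd_conductorNorm_iff_not_hasGoodReductionAtPrime`), hence listed (`mem_badPrimes_of_not_good`). The body of ty2's announced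
`Supersingular.PrasannaUnitGuard r.curve r.p`, stated structurally. [cite: SilvermanAEC2009, VII.5 Prop. 5.1(a) and C.16] -/
theorem prasannaGuard_of_check (hc : r.check = true) [r.curve.IsElliptic] [r.curve.IsGloballyMinimal]
    (h : r.prasannaGuardAt = true) : ∀ q ∈ (r.curve.conductorNorm ℤ).primeFactors, ¬ r.p ∣ q ^ 2 - 1 := by
  intro q hq
  have hqp : q.Prime := Nat.prime_of_mem_primeFactors hq
  haveI : Fact q.Prime := ⟨hqp⟩
  have hbad : ¬ r.curve.HasGoodReductionAtPrime q :=
    (r.curve.dvd_conductorNorm_iff_not_hasGoodReductionAtPrime q).mp (Nat.dvd_of_mem_primeFactors hq)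
  obtain ⟨t, ht, htq⟩ := r.exists_mem_bad_of_mem_badPrimes (r.mem_badPrimes_of_not_good hc hqp hbad)
  have hx := r.forall_bad_of_prasannaGuardAt h t ht
  rw [htq] at hx
  exact hx

/-- **The guard FAILS for a certified record WITHOUT the certificate** (kernel theorem): the offending listed prime `q` (`p ∣ q² − 1`)
is multiplicative (`mult_and_val_of_mem_bad`), hence a prime factor of `N`. [cite: SilvermanAEC2009, VII.5 Prop. 5.1(b) and C.16] -/
theorem not_prasannaGuard_of_check (hc : r.check = true) [r.curve.IsElliptic] [r.curve.IsGloballyMinimal]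
    (h : r.prasannaGuardAt = false) : ¬ ∀ q ∈ (r.curve.conductorNorm ℤ).primeFactors, ¬ r.p ∣ q ^ 2 - 1 := by
  intro hall
  have htrue : r.prasannaGuardAt = true := by
    refine List.all_eq_true.mpr fun t ht => ?_
    simp only [decide_eq_true_eq]
    haveI : Fact t.1.Prime := ⟨((r.support_data_of_check hc).1 t ht).1⟩
    obtain ⟨hm, -⟩ := r.mult_and_val_of_mem_bad hc ht
    exact hall t.1 (mem_primeFactors_conductorNorm_of_mult hm)
  rw [htrue] at h
  exact Bool.noConfusion h

/-- **Guard ∧ inert pair ⇒ narrowed inert pair**, record level (kernel theorem): a certified record with both certificates has an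
inert pair satisfying the pair-local unit conjunct of p574374. [cite: SilvermanAEC2009, VII.5 Prop. 5.1(b)] -/
theorem exists_inertPairCoprime_of_guard_of_check (hc : r.check = true) [r.curve.IsElliptic] [r.curve.IsGloballyMinimal]
    (hg : r.prasannaGuardAt = true) (hi : r.inertPairAt = true) :
    ∃ ℓ₁ ℓ₂ : ℕ, ∃ _ : Fact ℓ₁.Prime, ∃ _ : Fact ℓ₂.Prime, ℓ₁ ≠ ℓ₂ ∧
      r.curve.HasMultiplicativeReductionAtPrime ℓ₁ ∧ r.curve.HasMultiplicativeReductionAtPrime ℓ₂ ∧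
      ¬ r.p ∣ padicValInt ℓ₁ r.curve.minimalDiscriminantInt ∧ ¬ r.p ∣ padicValInt ℓ₂ r.curve.minimalDiscriminantInt ∧
      ¬ r.p ∣ (ℓ₁ ^ 2 - 1) * (ℓ₂ ^ 2 - 1) := by
  haveI := r.fact_prime_of_check hc
  exact exists_inertPairCoprime_of_guard_of_hasInertPair (r.prasannaGuard_of_check hc hg) (r.hasInertPair_of_check hc hi)

end Record

/-! ### §2 The census (kernel recount) -/

/-- **41 of the 113 records at `p ≥ 5` pass the all-`q` guard** (Err 40 of 107, Rest 1 of 6); all 41 carry an inert pair, hence a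
narrowed one; at `p = 3` none passes. Nesting at `p ≥ 5`: guard 41 ⊆ narrowed pair 103 ⊆ pair 113. [folklore] -/
theorem prasannaGuard_counts_allRecords :
    (allRecords.filter fun r => 5 ≤ r.p ∧ r.prasannaGuardAt = true).length = 41 ∧
    (allRecords.filter fun r => 5 ≤ r.p ∧ r.prasannaGuardAt = false).length = 72 ∧
    (allRecords.filter fun r => 5 ≤ r.p ∧ r.errAt = true ∧ r.prasannaGuardAt = true).length = 40 ∧
    (allRecords.filter fun r => 5 ≤ r.p ∧ r.restAt = true ∧ r.prasannaGuardAt = true).length = 1 ∧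
    (allRecords.filter fun r => 5 ≤ r.p ∧ r.prasannaGuardAt = true ∧ r.inertPairAt = true).length = 41 ∧
    (allRecords.filter fun r => 5 ≤ r.p ∧ r.prasannaGuardAt = true ∧ r.inertPairCoprimeAt = true).length = 41 ∧
    (allRecords.filter fun r => 5 ≤ r.p ∧ r.prasannaGuardAt = false ∧ r.inertPairCoprimeAt = true).length = 62 ∧
    (allRecords.filter fun r => r.p = 3 ∧ r.prasannaGuardAt = true).length = 0 := by
  decide +kernel

/-- By prime: 21/86 @ 5, 14/20 @ 7, 3/4 @ 11, 3/3 @ 13 pass the guard. [folklore] -/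
theorem prasannaGuard_counts_by_prime :
    (allRecords.filter fun r => r.p = 5 ∧ r.prasannaGuardAt = true).length = 21 ∧
    (allRecords.filter fun r => r.p = 7 ∧ r.prasannaGuardAt = true).length = 14 ∧
    (allRecords.filter fun r => r.p = 11 ∧ r.prasannaGuardAt = true).length = 3 ∧
    (allRecords.filter fun r => r.p = 13 ∧ r.prasannaGuardAt = true).length = 3 ∧
    (allRecords.filter fun r => r.p = 7).length = 20 ∧ (allRecords.filter fun r => r.p = 11).length = 4 ∧
    (allRecords.filter fun r => r.p = 13).length = 3 := by
  decide +kernel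

/-- **On every one of the 734 records, guard ∧ pair certificate ⇒ narrowed-pair certificate** (the Bool shadow of §0).
[folklore] -/
theorem inertPairCoprimeAt_of_guard_allRecords :
    (allRecords.all fun r => !(r.prasannaGuardAt && r.inertPairAt) || r.inertPairCoprimeAt) = true := by
  decide +kernel

/-- Distribution at `p ≥ 5` of the number of listed bad primes `q` with `p ∣ q² − 1` (`q ≡ ±1 (mod p)`): 0 on 41 records (the guard),
1 on 51, 2 on 19, 3 on 2. [folklore] -/
theorem offendingCount_five_le :
    (((allRecords.filter fun r => 5 ≤ r.p).map fun r => (r.bad.filter fun t => r.p ∣ t.1 ^ 2 - 1).length).count 0 = 41) ∧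
    (((allRecords.filter fun r => 5 ≤ r.p).map fun r => (r.bad.filter fun t => r.p ∣ t.1 ^ 2 - 1).length).count 1 = 51) ∧
    (((allRecords.filter fun r => 5 ≤ r.p).map fun r => (r.bad.filter fun t => r.p ∣ t.1 ^ 2 - 1).length).count 2 = 19) ∧
    (((allRecords.filter fun r => 5 ≤ r.p).map fun r => (r.bad.filter fun t => r.p ∣ t.1 ^ 2 - 1).length).count 3 = 2) := by
  decide +kernel

/-- **The 41 records at `p ≥ 5` passing the guard**, as `(label, p)`. [cite: Cremona2006, Table 1 (Cremona labels)] -/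
theorem prasannaGuard_five_le_labels :
    ((allRecords.filter fun r => 5 ≤ r.p ∧ r.prasannaGuardAt = true).map fun r => (r.label, r.p)) =
    [("11998a1", 5), ("15953a1", 5), ("20962b1", 5), ("46774a1", 5), ("65774b1", 5), ("71078b1", 5), ("78062a1", 5),
      ("100702b1", 5), ("105014c1", 5), ("129493b1", 5), ("145146q1", 5), ("159222ba1", 5), ("227838j1", 5), ("274858a1", 5),
      ("305506b1", 5), ("310658b1", 5), ("321218a1", 5), ("370947a1", 5), ("399027a1", 5), ("438006c1", 5), ("465698b1", 5),
      ("27466a1", 7), ("44115c1", 7), ("130798a1", 7), ("221371b1", 7), ("234718a1", 7), ("270618c1", 7), ("329754c1", 7),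
      ("333994a1", 7), ("344194b1", 7), ("385890f1", 7), ("393699a1", 7), ("399190l1", 7), ("441330q1", 7), ("487995d1", 7),
      ("275422d1", 11), ("297402n1", 11), ("300846p1", 11), ("236810a1", 13), ("362962a1", 13), ("421511a1", 13)] := by
  decide +kernel

/-- The Rest cells at `p ≥ 5` split by the guard: PASS `399190l1` only; FAIL `138594b1, 246697a1, 321518d1, 331554a1, 12927e1`.
[cite: Cremona2006, Table 1 (Cremona labels)] -/
theorem prasannaGuard_rest_labels :
    ((allRecords.filter fun r => 5 ≤ r.p ∧ r.restAt = true ∧ r.prasannaGuardAt = true).map Record.label) = ["399190l1"] ∧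
    ((allRecords.filter fun r => 5 ≤ r.p ∧ r.restAt = true ∧ r.prasannaGuardAt = false).map Record.label) =
      ["138594b1", "246697a1", "321518d1", "331554a1", "12927e1"] := by
  decide +kernel

/-- **The guard is DECIDED on the display**: for a listed record, guard `↔ prasannaGuardAt`. [cite: SilvermanAEC2009, VII.5 Prop. 5.1 and C.16] -/
theorem prasannaGuard_iff_of_mem (r : Record) (hr : r ∈ allRecords) :
    haveI := (r.elliptic_and_minimal_of_check (check_of_mem_of_certified certified_allRecords hr)).1
    haveI := (r.elliptic_and_minimal_of_check (check_of_mem_of_certified certified_allRecords hr)).2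
    (∀ q ∈ (r.curve.conductorNorm ℤ).primeFactors, ¬ r.p ∣ q ^ 2 - 1) ↔ r.prasannaGuardAt = true := by
  have hc := check_of_mem_of_certified certified_allRecords hr
  haveI := (r.elliptic_and_minimal_of_check hc).1
  haveI := (r.elliptic_and_minimal_of_check hc).2
  refine ⟨fun h => ?_, fun h => r.prasannaGuard_of_check hc h⟩
  by_contra hne
  exact r.not_prasannaGuard_of_check hc (Bool.eq_false_iff.mpr hne) h

/-! ### §3 `hWeq` adapters, the six Rest cells at `p ≥ 5` and the T3 witness cell -/

section Adapters

variable {rs : List Record} {W : WeierstrassCurve ℚ} [W.IsElliptic] [W.IsGloballyMinimal] {a1 a2 a3 a4 a6 : ℤ}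

/-- **The guard in the `hWeq` shape** from a certified list containing a record with these a-invariants, this `p` and the certificate.
[cite: SilvermanAEC2009, VII.5 Prop. 5.1(a) and C.16] -/
theorem prasannaGuard_of_exists (hrs : certified rs = true) {p : ℕ}
    (h : ∃ r ∈ rs, r.ainvs = [a1, a2, a3, a4, a6] ∧ r.p = p ∧ r.prasannaGuardAt = true) (hWeq : W = ⟨a1, a2, a3, a4, a6⟩) :
    ∀ q ∈ (W.conductorNorm ℤ).primeFactors, ¬ p ∣ q ^ 2 - 1 := by
  obtain ⟨r, hr, hA, hp, hcert⟩ := h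
  have hc := check_of_mem_of_certified hrs hr
  have hW : W = r.curve := by rw [hWeq]; exact r.curve_eq hA
  subst hW
  subst hp
  exact r.prasannaGuard_of_check hc hcert

/-- **Guard FAILURE in the `hWeq` shape** (certificate `false`). [cite: SilvermanAEC2009, VII.5 Prop. 5.1(b) and C.16] -/
theorem not_prasannaGuard_of_exists (hrs : certified rs = true) {p : ℕ}
    (h : ∃ r ∈ rs, r.ainvs = [a1, a2, a3, a4, a6] ∧ r.p = p ∧ r.prasannaGuardAt = false) (hWeq : W = ⟨a1, a2, a3, a4, a6⟩) :
    ¬ ∀ q ∈ (W.conductorNorm ℤ).primeFactors, ¬ p ∣ q ^ 2 - 1 := by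
  obtain ⟨r, hr, hA, hp, hcert⟩ := h
  have hc := check_of_mem_of_certified hrs hr
  have hW : W = r.curve := by rw [hWeq]; exact r.curve_eq hA
  subst hW
  subst hp
  exact r.not_prasannaGuard_of_check hc hcert

end Adapters

section RestCells

variable {W : WeierstrassCurve ℚ} [W.IsElliptic] [W.IsGloballyMinimal]

/-- `399190l1 @ 7` (Rest): bad `2, 5, 11, 19, 191 ≡ 2, 5, 4, 5, 2 (mod 7)` — PASSES the guard (the only Rest cell at `p ≥ 5` that does).
[cite: Cremona2006, Table 1 (Cremona label 399190l1)] -/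
theorem prasannaGuard_cell_399190l1_at7 (hWeq : W = ⟨1, -1, 1, -8615202972, -2594053676135591⟩) :
    ∀ q ∈ (W.conductorNorm ℤ).primeFactors, ¬ 7 ∣ q ^ 2 - 1 :=
  prasannaGuard_of_exists certified_records16 (by decide +kernel) hWeq

/-- `138594b1 @ 5` (Rest): bad `2, 3, 23099`; `23099 ≡ −1 (mod 5)` — FAILS the guard. [cite: Cremona2006, Table 1 (Cremona label 138594b1)] -/
theorem not_prasannaGuard_cell_138594b1_at5 (hWeq : W = ⟨1, 0, 0, -1443, -21219⟩) :
    ¬ ∀ q ∈ (W.conductorNorm ℤ).primeFactors, ¬ 5 ∣ q ^ 2 - 1 :=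
  not_prasannaGuard_of_exists certified_records14 (by decide +kernel) hWeq

/-- `246697a1 @ 5` (Rest): bad `11, 41, 547`; `11 ≡ 1`, `41 ≡ 1 (mod 5)` — FAILS the guard. [cite: Cremona2006, Table 1 (Cremona label 246697a1)] -/
theorem not_prasannaGuard_cell_246697a1_at5 (hWeq : W = ⟨0, 0, 1, -292934695, -1929764585205⟩) :
    ¬ ∀ q ∈ (W.conductorNorm ℤ).primeFactors, ¬ 5 ∣ q ^ 2 - 1 :=
  not_prasannaGuard_of_exists certified_records14 (by decide +kernel) hWeq

/-- `321518d1 @ 5` (Rest): bad `2, 19, 8461`; `19 ≡ −1`, `8461 ≡ 1 (mod 5)` — FAILS the guard. [cite: Cremona2006, Table 1 (Cremona label 321518d1)] -/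
theorem not_prasannaGuard_cell_321518d1_at5 (hWeq : W = ⟨1, 0, 0, -80858, -9082420⟩) :
    ¬ ∀ q ∈ (W.conductorNorm ℤ).primeFactors, ¬ 5 ∣ q ^ 2 - 1 :=
  not_prasannaGuard_of_exists certified_records15 (by decide +kernel) hWeq

/-- `331554a1 @ 5` (Rest): bad `2, 3, 55259`; `55259 ≡ −1 (mod 5)` — FAILS the guard. [cite: Cremona2006, Table 1 (Cremona label 331554a1)] -/
theorem not_prasannaGuard_cell_331554a1_at5 (hWeq : W = ⟨1, 0, 0, -3453, -78387⟩) :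
    ¬ ∀ q ∈ (W.conductorNorm ℤ).primeFactors, ¬ 5 ∣ q ^ 2 - 1 :=
  not_prasannaGuard_of_exists certified_records15 (by decide +kernel) hWeq

/-- `12927e1 @ 7` (Rest): bad `3, 31, 139`; `139 ≡ −1 (mod 7)` — FAILS the guard (though `(3, 31)` is a narrowed pair, p574374).
[cite: Cremona2006, Table 1 (Cremona label 12927e1)] -/
theorem not_prasannaGuard_cell_12927e1_at7 (hWeq : W = ⟨1, 0, 0, -42189461, -105479619702⟩) :
    ¬ ∀ q ∈ (W.conductorNorm ℤ).primeFactors, ¬ 7 ∣ q ^ 2 - 1 :=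
  not_prasannaGuard_of_exists certified_records16 (by decide +kernel) hWeq

/-- The route's T3 witness cell `22678e1 @ 5` (Err): bad `2, 17, 23, 29`; `29 ≡ −1 (mod 5)` — FAILS the guard (though `(17, 23)` is a
narrowed pair, p574374). [cite: Cremona2006, Table 1 (Cremona label 22678e1)] -/
theorem not_prasannaGuard_cell_22678e1_at5 (hWeq : W = ⟨1, 0, 0, 3140254662, -139987982322460⟩) :
    ¬ ∀ q ∈ (W.conductorNorm ℤ).primeFactors, ¬ 5 ∣ q ^ 2 - 1 :=
  not_prasannaGuard_of_exists certified_records14 (by decide +kernel) hWeq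

end RestCells

end Summit.BirchSwinnertonDyer.Rank1Residual.X6.PrintCert
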